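import Literature.NumberTheory.EllipticCurves.Wuthrich2014.ShaBoundProofs
import Literature.NumberTheory.EllipticCurves.Rank1Residual.Predicates
import HarnessLib

/-!
# BSD in analytic rank ≤ 1, residual class X1 (Eisenstein anomalous, good `p`): what the PUBLISHED record closes, without the Keller–Yin chain

HONEST FRAMING (cell `b2b-bsdres`, verbatim). The goal is to DELETE the COMBINATION-SHAPED residual
classes for ALL analytic-rank ≤ 1 curves over ℚ — "full BSD formula for every rank ≤ 1 curve in class
C" assembled STRICTLY from published theorems — so that the rank-≤1 remainder becomes exactly the
CONSTRUCTION-SHAPED classes, which are TYPED (missing-input Props), NOT attempted; this is not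
"finishing BSD". No internally-minted statement enters as a cited fact, and no preprint is used: the
announced result of Keller–Yin (arXiv:2402.12781v2, Thm. 3, unrefereed) that would cover the whole
class is NOT an input of this file (its typed form lives Summits-side as a labelled hypothesis).

Class X1 (RESIDUAL-CASES.md §a.2 of the `bsd-percentage` bundle; `bsdN/HYPOTHESES.md` rows T-CGS /
T-GV0): `p > 2`, `E[p]` reducible (`red(p)`), good reduction at `p` (`good(p)`), `a_p ≡ 1 (mod p)`
(`anom(p)`) [and `¬(r = 0 ∧ gvpar(p))`, a clause that only removes pairs covered by Greenberg–Vatsal,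
Invent. Math. 142 (2000), Thm. 1.3 — dropped here, so `IsClassX1` is a superset of X1 and every theorem
below holds on X1]. `BSD(E,p)` is Miller's `Literature.NumberTheory.EllipticCurves.BSDp` (LMS J.
Comput. Math. 14 (2011), Def. 1.1): rank part, finiteness of `Ш[p^∞]`, rationality of `#Ш_an`,
`ord_p #Ш_an = ord_p #Ш[p^∞]`.

What this file PROVES (independent patchwork: Wuthrich 2014 + Gross–Zagier–Kolyvagin + Cassels; no
CGLS/CGS input), for `W` a globally minimal model of `E`:
* `padicValNat_shaOrder_le_of_isClassX1` — rank 0 (`L(E,1) ≠ 0`), every X1 prime: the ONE-SIDED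
  bound `ord_p #Ш(E/ℚ) ≤ ord_p #Ш(E/ℚ)_an` (Wuthrich, Doc. Math. 19 (2014), Prop. 21 = his Thm. 16 with
  Kato's theorem and Greenberg's Euler-characteristic argument, as printed). This is all that is in
  print class-wide: the reverse inequality needs the opposite divisibility `(L_p(E)) ⊆ char_Λ X(E)` up
  to a UNIT of `Λ`, i.e. equality of `μ`-invariants at an anomalous Eisenstein prime — exactly the
  piece Greenberg–Vatsal 2000 (Thm. 1.3, `gvpar`) and Castella–Grossi–Skinner, Math. Ann. 393 (2025)
  (Thm. D, §1.2 — LaTeXML "Thm. 4" of the arXiv v1 store text —, `φ|_{G_p} ∉ {1, ω}`) do not supply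
  on X1.
* `bsdp_of_isClassX1_of_rank_zero` — **closed sub-class (r = 0): `p ∤ #Ш(E/ℚ)_an ⟹ BSD(E,p)`**
  (both inequalities: `0 ≤ ord_p #Ш ≤ ord_p #Ш_an = 0`).
* `bsdp_of_isClassX1_of_rank_zero_of_isIsogenous` — **closed sub-class up to isogeny (r = 0):
  `p ∤ #Ш(E'/ℚ)_an` for SOME `E'` `ℚ`-isogenous to `E` ⟹ `BSD(E,p)`** (Cassels' isogeny invariance,
  the tree fact `WeierstrassCurve.bsdRHS_eq_of_isIsogenous`). On the census of RESIDUAL-CASES.md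
  (N < 10⁴, collector 2026-08-18T16:56Z) this reaches all 300 rank-0 X1 pairs: 298 have `p ∤ #Ш_an`,
  and the two with `3 ∣ #Ш_an = 9` (`2366d1`, `7154c1`) are 3-isogenous to `2366d2`, `7154c2` with
  `#Ш_an = 1` (Cremona `allbsd`) — a prediction for the lane to certify, not a verdict.
* `forall_bsdp_of_isClassX1_of_rank_zero_of_cover` — the rank-0 class statement as ONE implication
  from the exact residual hypothesis (every X1 pair has such an `E'`).
* `bsdp_of_rank_one_of_primaryComponent_subsingleton` — rank 1: the CERTIFICATE form
  `Ш(E/ℚ)[p^∞] = 0 ∧ p ∤ #Ш_an ⟹ BSD(E,p)`; class-wide the published record (Miller–Stoll, Math.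
  Comp. 82 (2013) `p`-isogeny descent; Stein–Wuthrich, Math. Comp. 82 (2013) `p`-adic BSD inequality,
  extended to reducible `E[p]` by Wuthrich 2014 §6; Lawson–Wuthrich 2016 Thm. 14) gives only per-curve
  UPPER BOUNDS on `ord_p #Ш[p^∞]`, no class theorem; the rank-1 class statement is not a theorem in
  print (259 census pairs, 235 at `p = 3`) and is typed Summits-side, not here.

Published inputs, BY NAME (all `def … : Prop` facts of the tree with verbatim citations):
`Wuthrich2014.sha_dvd_analyticSha` (Wuthrich 2014, Prop. 21), `rank_eq_analyticRank_of_analyticRank_le_one`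
(Gross–Zagier 1986 + Kolyvagin 1990; Darmon 2004, Thm. 3.22), `WeierstrassCurve.bsdRHS_eq_of_isIsogenous`
(Cassels 1965; Milne *ADT* Thm. I.7.3). Proved in the tree and used: Faltings' isogeny theorem for
`L(E,s)` (`entireLFunction_eq_of_isIsogenous'`), `tamagawaProduct_pos_holds`, `regulator_eq_one_of_rank_zero`.
References: [Wuthrich2014] Prop. 21; [Miller2011LMS] Def. 1.1; [MilneADT2006] Thm. I.7.3;
[CastellaGrossiSkinner2025] Thm. D (§1.2; arXiv v1 LaTeXML "Thm. 4"); [GreenbergVatsal2000] Thm. 1.3;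
[MillerStoll2012] Thm. 9.1.
-/

set_option autoImplicit false

noncomputable section

open scoped Classical

open WeierstrassCurve Literature.NumberTheory.EllipticCurves
  Literature.NumberTheory.EllipticCurves.Wuthrich2014

namespace Literature.NumberTheory.EllipticCurves.Rank1Residual

/-! ### The class predicate X1 (Eisenstein anomalous, good) and the class theorems -/

/-- **Residual class X1 (superset form): `p` is an odd, good, anomalous Eisenstein prime of `E`.**
`p ≠ 2`; `E` has good reduction at `p` (`good(p)`); `E[p]` is a reducible `G_ℚ`-module, i.e. `E`
admits a rational `p`-isogeny (`red(p)`, `¬ HasIrreducibleModPGaloisRep`); and `a_p(E) ≡ 1 (mod p)`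
(`anom(p)`: the two characters of `E[p]^{ss}|_{G_p}` are `{1, ω}`, the case excluded by
Castella–Grossi–Skinner, Math. Ann. 393 (2025), Thm. D [arXiv v1 LaTeXML: Thm. 4]). This is the
predicate X1 of the residual
census (RESIDUAL-CASES.md §a.2, `bsdN/HYPOTHESES.md` rows T-CGS/T-GV0) WITHOUT its clause
`¬(r = 0 ∧ gvpar(p))` (which only removes the pairs covered by Greenberg–Vatsal 2000, Thm. 1.3); every
theorem below holds on this superset, hence on X1. At such a prime the reduction is ordinary
(`p ∤ a_p` since `a_p ≡ 1`). [cite: CastellaGrossiSkinner2025, Theorem D, §1.2 (the excluded case `φ|_{G_p} ∈ {1, ω}`; arXiv v1 LaTeXML: Thm. 4, §0.3)] -/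
def IsClassX1 (W : WeierstrassCurve ℚ) [W.IsGloballyMinimal] (p : ℕ) [Fact p.Prime] : Prop :=
  p ≠ 2 ∧ W.HasGoodReductionAtPrime p ∧ ¬ W.HasIrreducibleModPGaloisRep p ∧
    (p : ℤ) ∣ W.frobeniusTrace p - 1

namespace IsClassX1

variable {W : WeierstrassCurve ℚ} [W.IsGloballyMinimal] {p : ℕ} [Fact p.Prime]

/-- A class-X1 prime is odd. [folklore] -/
theorem two_ne (h : IsClassX1 W p) : p ≠ 2 := h.1

/-- A class-X1 prime is a prime of good reduction. [folklore] -/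
theorem hasGoodReductionAtPrime (h : IsClassX1 W p) : W.HasGoodReductionAtPrime p := h.2.1

/-- At a class-X1 prime `E[p]` is reducible. [folklore] -/
theorem not_hasIrreducibleModPGaloisRep (h : IsClassX1 W p) : ¬ W.HasIrreducibleModPGaloisRep p :=
  h.2.2.1

/-- A class-X1 prime is anomalous: `a_p ≡ 1 (mod p)`. [folklore] -/
theorem dvd_frobeniusTrace_sub_one (h : IsClassX1 W p) : (p : ℤ) ∣ W.frobeniusTrace p - 1 := h.2.2.2

/-- A class-X1 prime is not a prime of additive reduction (good reduction excludes additive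
reduction of the `ℤ_p`-minimal model, Mathlib `HasGoodReduction.not_hasAdditiveReduction`).
[folklore] -/
theorem not_hasAdditiveReduction (h : IsClassX1 W p) :
    ¬ ((W.baseChange ℚ_[p]).minimal ℤ_[p]).HasAdditiveReduction ℤ_[p] :=
  WeierstrassCurve.HasGoodReduction.not_hasAdditiveReduction (R := ℤ_[p]) h.2.1

/-- A class-X1 prime is ordinary: `p ∤ a_p` (as `p ∣ a_p - 1` and `p ∤ 1`). [folklore] -/
theorem not_dvd_frobeniusTrace (h : IsClassX1 W p) : ¬ (p : ℤ) ∣ W.frobeniusTrace p := by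
  intro hd
  have h1 : (p : ℤ) ∣ 1 := by
    have := Int.dvd_sub hd h.2.2.2
    simpa using this
  have hp := (Fact.out : p.Prime).one_lt
  have : (p : ℤ) ≤ 1 := Int.le_of_dvd one_pos h1
  omega

end IsClassX1

/-- **Class X1, analytic rank 0, one-sided: `ord_p #Ш(E/ℚ) ≤ ord_p #Ш(E/ℚ)_an`** for every `E/ℚ`
with `L(E,1) ≠ 0` and every class-X1 prime `p` of `E` (Wuthrich 2014, Prop. 21, with
Gross–Zagier–Kolyvagin for the finiteness of `E(ℚ)` and `Ш`). This is ALL the published record gives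
class-wide in the direction "`Ш` is small"; the reverse inequality is the missing input of the class
(typed Summits-side). [cite: Wuthrich2014, Prop. 21 (p. 400)] -/
theorem padicValNat_shaOrder_le_of_isClassX1 (hW : sha_dvd_analyticSha)
    (hGZK : rank_eq_analyticRank_of_analyticRank_le_one)
    (W : WeierstrassCurve ℚ) [W.IsElliptic] [W.IsGloballyMinimal] (p : ℕ) [Fact p.Prime]
    (hX1 : IsClassX1 W p) (hL : W.entireLFunction 1 ≠ 0) :
    ∃ q : ℚ, shaAn W = (q : ℂ) ∧ q ≠ 0 ∧ (padicValNat p W.shaOrder : ℤ) ≤ padicValRat p q := by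
  have hr0 : W.analyticRank = 0 := analyticRank_eq_zero_of_entireLFunction_one_ne_zero W hL
  obtain ⟨hrank, hfin⟩ := hGZK W (by rw [hr0]; exact zero_le_one)
  have hmw0 : W.mordellWeilRank = 0 := by rw [hrank, hr0]
  haveI hE : Finite W.toAffine.Point := W.finite_point_of_rank_zero hmw0
  obtain ⟨q, hq, hq0, hle⟩ := padicValNat_shaOrder_le_of_sha_dvd hW W p hX1.two_ne hL hE hfin
    hX1.not_hasAdditiveReduction (Or.inl hX1.not_hasIrreducibleModPGaloisRep)
  obtain ⟨-, -, -, hshaAn⟩ := shaAn_eq_of_L_one_div_eq hGZK W hL hq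
  have hcard : (Nat.card W.toAffine.Point : ℚ) ≠ 0 := by
    exact_mod_cast (Nat.card_pos (α := W.toAffine.Point)).ne'
  have htam : (W.tamagawaProduct : ℚ) ≠ 0 := by
    exact_mod_cast (W.tamagawaProduct_pos_holds : 0 < W.tamagawaProduct).ne'
  exact ⟨_, hshaAn, div_ne_zero (mul_ne_zero hq0 (pow_ne_zero 2 hcard)) htam, hle⟩

/-- **Class X1, analytic rank 0, closed sub-class: `p ∤ #Ш(E/ℚ)_an ⟹ BSD(E,p)`.** For every `E/ℚ`
with `L(E,1) ≠ 0` (globally minimal `W`), every class-X1 prime `p` of `E` and `#Ш(E/ℚ)_an` a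
rational number of `p`-adic valuation `0`, Miller's `BSD(E,p)` holds. Published inputs: Wuthrich
2014, Prop. 21 (`hW`); Gross–Zagier–Kolyvagin (`hGZK`). This is lever L1 of RESIDUAL-CASES.md §a.3
restricted to X1, kernel-checked. [cite: Wuthrich2014, Prop. 21 (p. 400)]
[cite: Miller2011LMS, Def. 1.1 (arXiv:1010.2431 p. 3)] -/
theorem bsdp_of_isClassX1_of_rank_zero (hW : sha_dvd_analyticSha)
    (hGZK : rank_eq_analyticRank_of_analyticRank_le_one)
    (W : WeierstrassCurve ℚ) [W.IsElliptic] [W.IsGloballyMinimal] (p : ℕ) [Fact p.Prime]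
    (hX1 : IsClassX1 W p) (hL : W.entireLFunction 1 ≠ 0)
    (hunit : ∃ q : ℚ, shaAn W = (q : ℂ) ∧ padicValRat p q = 0) : BSDp W p :=
  bsdp_of_L_one_ne_zero_of_padicValRat_shaAn_eq_zero hW hGZK W p hX1.two_ne hL
    hX1.not_hasAdditiveReduction (Or.inl hX1.not_hasIrreducibleModPGaloisRep) hunit

/-- **Class X1, analytic rank 0, closed sub-class up to isogeny: if SOME curve `E'` in the
`ℚ`-isogeny class of `E` has a class-X1 prime `p` with `p ∤ #Ш(E'/ℚ)_an`, then `BSD(E,p)`.**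
(Cassels' isogeny invariance `hCassels` transports `BSD(E',p)` — obtained from Wuthrich's Prop. 21
for `E'` — back to `E`; `L(E,1) = L(E',1) ≠ 0` by Faltings.) In the residual census this upgrade
absorbs the rank-0 X1 pairs with `p ∣ #Ш(E)_an` whose isogeny class contains a curve with
`p ∤ #Ш_an` (e.g. `2366d1`, `7154c1` at `p = 3`, via `2366d2`, `7154c2`).
[cite: Wuthrich2014, Prop. 21 (p. 400)] [cite: MilneADT2006, Thm. I.7.3 and Remark I.7.4] -/
theorem bsdp_of_isClassX1_of_rank_zero_of_isIsogenous (hW : sha_dvd_analyticSha)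
    (hGZK : rank_eq_analyticRank_of_analyticRank_le_one) (hCassels : bsdRHS_eq_of_isIsogenous)
    (W W' : WeierstrassCurve ℚ) [W.IsElliptic] [W'.IsElliptic] [W.IsGloballyMinimal]
    [W'.IsGloballyMinimal] (hiso : IsIsogenous W W') (p : ℕ) [Fact p.Prime]
    (hX1' : IsClassX1 W' p) (hL : W.entireLFunction 1 ≠ 0)
    (hunit' : ∃ q : ℚ, shaAn W' = (q : ℂ) ∧ padicValRat p q = 0) : BSDp W p := by
  have hL' : W'.entireLFunction 1 ≠ 0 := by
    rwa [← entireLFunction_eq_of_isIsogenous' hiso]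
  have h' : BSDp W' p := bsdp_of_isClassX1_of_rank_zero hW hGZK W' p hX1' hL' hunit'
  have hr0 : W'.analyticRank = 0 := analyticRank_eq_zero_of_entireLFunction_one_ne_zero W' hL'
  obtain ⟨-, hfin'⟩ := hGZK W' (by rw [hr0]; exact zero_le_one)
  have hlead : W'.leadingLCoeff ≠ 0 := by
    rwa [W'.leadingLCoeff_eq_of_analyticRank_eq_zero hr0]
  exact bsdp_of_isIsogenous hCassels hiso hfin' hlead h'

/-- **Class X1, analytic rank 1, certificate form: `Ш(E/ℚ)[p^∞] = 0 ∧ p ∤ #Ш(E/ℚ)_an ⟹ BSD(E,p)`.**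
For `E/ℚ` with `ord_{s=1} L(E,s) = 1` (so `rank E(ℚ) = 1` and `Ш(E/ℚ)` finite,
Gross–Zagier–Kolyvagin `hGZK`), if the `p`-primary part of `Ш` is trivial — as certified for an
individual curve by a published per-curve method: an explicit `p`-isogeny descent (Miller–Stoll, Math.
Comp. 82 (2013)), the `p`-adic BSD inequality (Stein–Wuthrich, Math. Comp. 82 (2013), extended to
reducible `E[p]` by Wuthrich 2014 §6), or a Heegner-index bound (Lawson–Wuthrich 2016, Thm. 14) — and
`#Ш(E/ℚ)_an` is a rational number prime to `p`, then `BSD(E,p)`. Pure bookkeeping; it records that in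
rank 1 the published record offers class X1 only per-curve CERTIFICATES (upper bounds), no class
theorem (the rank-1 class statement is typed Summits-side). [cite: Miller2011LMS, Def. 1.1 (arXiv:1010.2431 p. 3)]
[cite: MillerStoll2012, Thm. 9.1] -/
theorem bsdp_of_rank_one_of_primaryComponent_subsingleton
    (hGZK : rank_eq_analyticRank_of_analyticRank_le_one)
    (W : WeierstrassCurve ℚ) [W.IsElliptic] [W.IsGloballyMinimal] (p : ℕ) [Fact p.Prime]
    (hr : W.analyticRank = 1)
    (hsha : Subsingleton (AddCommGroup.primaryComponent W.sha p))
    (hunit : ∃ q : ℚ, shaAn W = (q : ℂ) ∧ padicValRat p q = 0) : BSDp W p := by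
  obtain ⟨hrank, hfin⟩ := hGZK W (by rw [hr])
  haveI := hfin
  obtain ⟨q, hq, hv⟩ := hunit
  refine ⟨hrank, Finite.of_subsingleton, q, hq, ?_⟩
  haveI := hsha
  rw [hv, Nat.card_of_subsingleton (⟨0, zero_mem _⟩ : AddCommGroup.primaryComponent W.sha p)]
  simp



/-- **What the published record closes of the rank-0 class statement, as one implication**: if every
X1 pair `(E,p)` with `L(E,1) ≠ 0` admits a `ℚ`-isogenous `E'` (globally minimal, X1 at `p`) with
`p ∤ #Ш(E'/ℚ)_an`, then `BSD(E,p)` holds for every rank-0 X1 pair — by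
`bsdp_of_isClassX1_of_rank_zero_of_isIsogenous` from Wuthrich 2014 Prop. 21, Gross–Zagier–Kolyvagin and
Cassels. The hypothesis `hcover` is the exact residual condition of the class in rank 0; it is
satisfied by every rank-0 X1 pair of the census N < 10⁴.
[cite: Wuthrich2014, Prop. 21 (p. 400)] [cite: MilneADT2006, Thm. I.7.3] -/
theorem forall_bsdp_of_isClassX1_of_rank_zero_of_cover (hW : sha_dvd_analyticSha)
    (hGZK : rank_eq_analyticRank_of_analyticRank_le_one) (hCassels : bsdRHS_eq_of_isIsogenous)
    (hcover : ∀ (W : WeierstrassCurve ℚ) [W.IsElliptic] [W.IsGloballyMinimal] (p : ℕ) [Fact p.Prime],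
      IsClassX1 W p → W.entireLFunction 1 ≠ 0 →
      ∃ (W' : WeierstrassCurve ℚ) (_ : W'.IsElliptic) (_ : W'.IsGloballyMinimal),
        IsIsogenous W W' ∧ IsClassX1 W' p ∧ ∃ q : ℚ, shaAn W' = (q : ℂ) ∧ padicValRat p q = 0)
    (W : WeierstrassCurve ℚ) [W.IsElliptic] [W.IsGloballyMinimal] (p : ℕ) [Fact p.Prime]
    (hX1 : IsClassX1 W p) (hL : W.entireLFunction 1 ≠ 0) : BSDp W p := by
  obtain ⟨W', hE', hmin', hiso, hX1', hunit'⟩ := hcover W p hX1 hL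
  haveI := hE'
  haveI := hmin'
  exact bsdp_of_isClassX1_of_rank_zero_of_isIsogenous hW hGZK hCassels W W' hiso p hX1' hL hunit'


/-! ### Bridge to the census predicate `ClassX1` (file `Predicates`) and the canonical-shape statements

Appended 2026-08-18 (same author): the literature seat's `ClassX1 W p := 2 < p ∧ Red W p ∧ Good W p ∧
Anom W p ∧ ¬(W.analyticRank = 0 ∧ GVPar W p)` is the EXACT census predicate; `IsClassX1` above is its
superset without the `gvpar` clause. The theorems are restated in the cell's canonical shape
`W.analyticRank ≤ 1 → ClassX1 W p → … → BSDp W p` (the extra binders are the sub-class conditions). -/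

/-- The exact census predicate `ClassX1` implies the superset predicate `IsClassX1` of this file
(drop the clause `¬(r = 0 ∧ gvpar(p))`; `2 < p` gives `p ≠ 2`). [folklore] -/
theorem isClassX1_of_classX1 {W : WeierstrassCurve ℚ} [W.IsGloballyMinimal] {p : ℕ} [Fact p.Prime]
    (h : ClassX1 W p) : IsClassX1 W p :=
  ⟨by have := h.1; omega, h.2.2.1, h.2.1, h.2.2.2.1.2.2⟩

/-- **Canonical shape, rank 0, closed sub-class `p ∤ #Ш_an`:** for every elliptic `W` (globally
minimal) and prime `p` with `W.analyticRank ≤ 1`, `ClassX1 W p`, `L(E,1) ≠ 0` and `#Ш(E/ℚ)_an` a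
rational of `p`-adic valuation `0`: `BSDp W p`. Inputs by name: Wuthrich 2014 Prop. 21 (`hW`),
Gross–Zagier–Kolyvagin (`hGZK`). [cite: Wuthrich2014, Prop. 21 (p. 400)] -/
theorem bsdp_of_classX1_of_L_one_ne_zero (hW : sha_dvd_analyticSha)
    (hGZK : rank_eq_analyticRank_of_analyticRank_le_one)
    (W : WeierstrassCurve ℚ) [W.IsElliptic] [W.IsGloballyMinimal] (p : ℕ) [Fact p.Prime]
    (_hr : W.analyticRank ≤ 1) (hX1 : ClassX1 W p) (hL : W.entireLFunction 1 ≠ 0)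
    (hunit : ∃ q : ℚ, shaAn W = (q : ℂ) ∧ padicValRat p q = 0) : BSDp W p :=
  bsdp_of_isClassX1_of_rank_zero hW hGZK W p (isClassX1_of_classX1 hX1) hL hunit

/-- **Canonical shape, rank 0 as `W.analyticRank = 0`** (modularity `hmod`, Breuil–Conrad–Diamond–
Taylor, converts `r_an = 0` into `L(E,1) ≠ 0`): `W.analyticRank ≤ 1 → ClassX1 W p → W.analyticRank = 0 →
p ∤ #Ш_an → BSDp W p`. [cite: Wuthrich2014, Prop. 21 (p. 400)] [cite: BCDTJAMS2001, Theorem A] -/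
theorem bsdp_of_classX1_of_analyticRank_eq_zero (hmod : hasEntireLFunction_rat)
    (hW : sha_dvd_analyticSha) (hGZK : rank_eq_analyticRank_of_analyticRank_le_one)
    (W : WeierstrassCurve ℚ) [W.IsElliptic] [W.IsGloballyMinimal] (p : ℕ) [Fact p.Prime]
    (hr : W.analyticRank ≤ 1) (hX1 : ClassX1 W p) (hr0 : W.analyticRank = 0)
    (hunit : ∃ q : ℚ, shaAn W = (q : ℂ) ∧ padicValRat p q = 0) : BSDp W p :=
  bsdp_of_classX1_of_L_one_ne_zero hW hGZK W p hr hX1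
    ((W.analyticRank_eq_zero_iff_holds (hmod W)).mp hr0) hunit

/-- **Canonical shape, rank 0, up to isogeny:** `W.analyticRank ≤ 1 → L(W,1) ≠ 0 →` (some
`ℚ`-isogenous globally minimal `W'` with `ClassX1 W' p` and `p ∤ #Ш(W')_an`) `→ BSDp W p`; Cassels'
invariance `hCassels` added to the inputs. [cite: Wuthrich2014, Prop. 21 (p. 400)]
[cite: MilneADT2006, Thm. I.7.3] -/
theorem bsdp_of_classX1_of_L_one_ne_zero_of_isIsogenous (hW : sha_dvd_analyticSha)
    (hGZK : rank_eq_analyticRank_of_analyticRank_le_one) (hCassels : bsdRHS_eq_of_isIsogenous)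
    (W W' : WeierstrassCurve ℚ) [W.IsElliptic] [W'.IsElliptic] [W.IsGloballyMinimal]
    [W'.IsGloballyMinimal] (hiso : IsIsogenous W W') (p : ℕ) [Fact p.Prime]
    (_hr : W.analyticRank ≤ 1) (hX1' : ClassX1 W' p) (hL : W.entireLFunction 1 ≠ 0)
    (hunit' : ∃ q : ℚ, shaAn W' = (q : ℂ) ∧ padicValRat p q = 0) : BSDp W p :=
  bsdp_of_isClassX1_of_rank_zero_of_isIsogenous hW hGZK hCassels W W' hiso p
    (isClassX1_of_classX1 hX1') hL hunit'

/-- **Canonical shape, rank 0, one-sided:** `W.analyticRank ≤ 1 → ClassX1 W p → L(W,1) ≠ 0 →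
ord_p #Ш(E/ℚ) ≤ ord_p #Ш(E/ℚ)_an` (with `#Ш_an ∈ ℚˣ`). The reverse inequality is NOT in print on X1.
[cite: Wuthrich2014, Prop. 21 (p. 400)] -/
theorem padicValNat_shaOrder_le_of_classX1 (hW : sha_dvd_analyticSha)
    (hGZK : rank_eq_analyticRank_of_analyticRank_le_one)
    (W : WeierstrassCurve ℚ) [W.IsElliptic] [W.IsGloballyMinimal] (p : ℕ) [Fact p.Prime]
    (_hr : W.analyticRank ≤ 1) (hX1 : ClassX1 W p) (hL : W.entireLFunction 1 ≠ 0) :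
    ∃ q : ℚ, shaAn W = (q : ℂ) ∧ q ≠ 0 ∧ (padicValNat p W.shaOrder : ℤ) ≤ padicValRat p q :=
  padicValNat_shaOrder_le_of_isClassX1 hW hGZK W p (isClassX1_of_classX1 hX1) hL

/-- **Canonical shape, rank 1, certificate form:** `W.analyticRank ≤ 1 → ClassX1 W p →
W.analyticRank = 1 → Ш(E/ℚ)[p^∞] = 0 → p ∤ #Ш_an → BSDp W p` (Gross–Zagier–Kolyvagin `hGZK` for the
rank clause; the class hypothesis is not used by the bookkeeping and is kept for the census shape).
[cite: Miller2011LMS, Def. 1.1 (arXiv:1010.2431 p. 3)] -/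
theorem bsdp_of_classX1_of_analyticRank_eq_one_of_subsingleton
    (hGZK : rank_eq_analyticRank_of_analyticRank_le_one)
    (W : WeierstrassCurve ℚ) [W.IsElliptic] [W.IsGloballyMinimal] (p : ℕ) [Fact p.Prime]
    (_hr : W.analyticRank ≤ 1) (_hX1 : ClassX1 W p) (hr1 : W.analyticRank = 1)
    (hsha : Subsingleton (AddCommGroup.primaryComponent W.sha p))
    (hunit : ∃ q : ℚ, shaAn W = (q : ℂ) ∧ padicValRat p q = 0) : BSDp W p :=
  bsdp_of_rank_one_of_primaryComponent_subsingleton hGZK W p hr1 hsha hunit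

end Literature.NumberTheory.EllipticCurves.Rank1Residual

end
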